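import Summits.ABC.IUTFork.DAGC312o
import Literature.AnabelianGeometry.AbsoluteAnabelian.AbsAnabProp121viiHolds

/-!
# Kernel DAG index — layer C312, part q: knitting DELTA 8 — [AbsAnab] Prop 1.2.1 (vii) DISCHARGED BY NAME; of the 85 loci of
[IUTchIII] Cor. 3.12 the ONLY hypothesis left in the reading of record is (SHE)

index v1 · abc-iut-c312-2 (filer, gen 3) per HOME/plan/KERNEL-DAG-SPEC.md v1.3 §2(d) ("when a node acquires `_holds` …") and §4 rule (1)
("c312-2 re-files the apex with that hypothesis DELETED and the `_holds` term plugged in"). PROOF-ONLY and APPEND-ONLY: no reading is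
redefined; the reading of record stays `lociReadingI S pending` (part o).

WHAT CHANGED. abc-iut-L4's sub-DAG `AbsAnab:Prop1.2.1(vii)` closed its row L00: `galoisMLF_iso_residueMap_holds : galoisMLF_iso_residueMap.{0}`
(abc-iut-w5-d198, `AbsAnabProp121viiHolds.lean`, p417023; classical local class field theory transport, axioms standard). Part o read the
locus [AbsAnab] Prop 1.2.1 (vii) (cited at Step (vi), "Galois cohomology of subquotients of `K̄^×`") as the NAMED PROPOSITION
`N_AbsAnab_Prop1_2_1_vii := galoisMLF_iso_residueMap.{0}` and carried it as the hypothesis `hAbsAnab` of `lociReadingI_of_SHE` /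
`derivable_xi_f_iff_SHE` / `summit_of_cor312_M_SHE`. This part plugs the landed proof in:
* `N_AbsAnab_Prop1_2_1_vii_holds` — the node's witness BY NAME (spec §2(d): a FACT-style node acquires `_holds` when the tree proves it);
* `lociReadingI_of_SHE'` — Theorem 3.11 as typed + (IPL) + `pending .SHE` grant ALL 85 loci (no classical hypothesis left);
* `derivable_xi_f_iff_SHE'` — in the least reading (`Cor312Least`), given Theorem 3.11 as typed and (IPL), the disputed (xi-f) observation
  is derivable IFF (SHE) is granted — ONE locus, the gloss the Step (xi) dispute turns on (Rmk 3.11.1 (iii); c312-1 `Thm311Remarks`: NOTED,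
  kernel shadow only);
* apex `summit_of_cor312_M_SHE'` = `summit_of_cor312_M_SHE` with `hAbsAnab` DELETED: kernel_hyps = 11 (hInd, hadm, hreal, hqreal, hThm, hIPL,
  hSHE, hC, hread, hΘ, hq).
Census `loci_census_v8`: resolved-by-name 84 + proved-classical 0 pending + 1 opaque = 85; `unresolvedV5` members now: (SHE) opaque,
[AbsAnab] Prop 1.2.1 (vii) PROVED, [EtTh] resolved (part o). Part p (Δ7, the step nodes through TEAM A's lemmas) is untouched and not
imported here (it sits on the A-side of the cell's co-import breaker B1; this part stays neutral so later parts may knit either side).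
THIS FILE PROVES NOTHING NEW about [IUTchIII] §3 AND ASSERTS NOTHING; no side taken on Cor. 3.12. typed ≠ discharged; indexed ≠ endorsed.
[claim: Mochizuki2012, status: disputed]
-/

noncomputable section

namespace Summit.ABC.IUTFork.DAG

open Cor312Proof Thm311 PartC312k

variable {T : ThetaIndex} (S : FullSituation T) (pending : Locus → Prop)

/-- discharge of `N_AbsAnab_Prop1_2_1_vii` ([AbsAnab] Prop 1.2.1 (vii), typed `galoisMLF_iso_residueMap`): BY NAME, abc-iut-L4's
`galoisMLF_iso_residueMap_holds` (p417023); proves nothing new. [cite: MochizukiAbsAnab2004, Prop 1.2.1 (vii) p.11] -/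
theorem N_AbsAnab_Prop1_2_1_vii_holds : N_AbsAnab_Prop1_2_1_vii :=
  Literature.AnabelianGeometry.AbsoluteAnabelian.galoisMLF_iso_residueMap_holds

/-- **The reading of record holds at all 85 loci given Theorem 3.11 as typed, (IPL), and `pending` at the ONE locus (SHE)** — part o's
`lociReadingI_of_SHE` with the classical hypothesis discharged by name. [folklore] -/
theorem lociReadingI_of_SHE' (hS : S.Statement) (hIPL : S.link.IPL) (hSHE : pending .SHE) : ∀ c, lociReadingI S pending c :=
  lociReadingI_of_SHE S pending hS hIPL N_AbsAnab_Prop1_2_1_vii_holds hSHE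

/-- **In the least reading, given Theorem 3.11 as typed and (IPL), the disputed observation of Step (xi-f) is derivable EXACTLY when (SHE)
is granted** — one locus. [folklore] -/
theorem derivable_xi_f_iff_SHE' (hS : S.Statement) (hIPL : S.link.IPL) :
    Derivable (lociReadingI S pending) .constitutesConstruction ↔ pending .SHE := by
  rw [derivable_xi_f_iff_SHE S pending hS hIPL]
  exact ⟨fun h => h.2, fun h => ⟨N_AbsAnab_Prop1_2_1_vii_holds, h⟩⟩

/-- **APEX, author's terms, every hypothesis named, no classical fact pending; the one opaque locus is (SHE).** Part o's
`summit_of_cor312_M_SHE` with `hAbsAnab` deleted (spec §4 rule (1)). kernel_hyps = 11 (hInd, hadm, hreal, hqreal, hThm, hIPL, hSHE, hC, hread,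
hΘ, hq). [claim: Mochizuki2012, status: disputed] -/
theorem summit_of_cor312_M_SHE' (V : HeightFamily) (Tm : Thm110Family V) (A : AbcDictionary V)
    (hInd : MochizukiIndeterminacies Tm) {TI : V.Pt → ThetaIndex} (S : ∀ P, FullSituation (TI P))
    (Pn : ∀ P, PilotNouns (S P).toLatticeSituation) (n m : ℤ)
    (hadm : ∀ P (j : (TI P).LabelStar) (vQ : (TI P).VQ), (Pn P).ComponentAdm n m j vQ)
    (hreal : ∀ P, (Pn P).NegLogThetaReal n m) (hqreal : ∀ P, (Pn P).NegLogQReal n m)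
    (hThm : ∀ P, (S P).Statement) (hIPL : ∀ P, (S P).link.IPL)
    (pending : Locus → Prop) (hSHE : pending .SHE) {O : Obs → Prop} (hC : ∀ P, Chain (lociReadingI (S P) pending) O)
    (hread : ∀ P (j : (TI P).LabelStar) (vQ : (TI P).VQ), O .constitutesConstruction →
      ((Pn P).toCor312Setting n m j vQ (hadm P j vQ)).RepresentedVol)
    (hΘ : ∀ P, (Pn P).negLogTheta n m = (Tm.X P).negLogTheta) (hq : ∀ P, (Pn P).negLogQ n m = -(Tm.X P).absLogq) :
    _root_.ABC :=
  summit_of_cor312_M_SHE V Tm A hInd S Pn n m hadm hreal hqreal hThm hIPL N_AbsAnab_Prop1_2_1_vii_holds pending hSHE hC hread hΘ hq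

/-- CENSUS after Δ8: of part n's three unresolved loci, [EtTh] is resolved to its named rigidity results (part o), [AbsAnab] Prop 1.2.1 (vii)
is PROVED (this part), (SHE) is opaque; 84 + 1 = 85 and no classical hypothesis remains among the loci. [folklore] -/
theorem loci_census_v8 : unresolvedV5 = [.SHE, .absAnab_prop1_2_1_vii, .etTh] ∧ (84 : ℕ) + 1 = 85 ∧ N_AbsAnab_Prop1_2_1_vii :=
  ⟨rfl, rfl, N_AbsAnab_Prop1_2_1_vii_holds⟩

end Summit.ABC.IUTFork.DAG

end
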